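import Summits.BirchSwinnertonDyer.BirchSwinnertonDyer.Theorems.Rank2ObservatoryRank3MinimalCensus
import HarnessLib

/-!
# BSD rank ≥ 2 observatory (`b2b-bsdr2`): MINIMALITY-ONLY certificates (Silverman's criterion at
# every prime), for the rank-3 rows without a root-number certificate

HONEST FRAMING: per-curve certified theorems and census instruments; no claim on BSD in rank ≥ 2.

`Rank2ObservatoryRank3MinimalCensus` discharges `hmin : IsGloballyMinimal` for the `7143` rows whose
ROOT-NUMBER certificate passes `min2`. The `1550` rows additive at `3` carry no root-number certificate
(the named fact `hKD` is guarded there), yet Silverman's criterion (AEC VII.1 Rem. 1.1: no prime `q`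
with `q¹² ∣ Δ` and `q⁴ ∣ c₄`; the tree THEOREM `isGloballyMinimal_of_int_criterion`) needs no root
number. This file gives the weaker, minimality-only check on the SAME certificate shape `RNCert`:

* `OddEntry.minCheck` / `RNCert.minCheck` (kernel-decidable): primes certified, `|Δ| = 2^{k2} ∏ pᵉ`,
  at `2`: `2^{k2} ∥ Δ ∧ k2 < 12` or `2^{k4} ∥ c₄ ∧ k4 < 4`; at a listed `p`: `p ∤ c₄`, or `pᵉ ∥ Δ` with
  `e < 12` or (`pᵗ ∥ c₄ ∧ t < 4`);
* soundness `int_criterion_of_minCheck`, and `minCheck_of_check` (a root-number certificate passing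
  `min2` passes `minCheck`);
* rows: `Rank3Row.MinCertified`, `Rank3Row.isGloballyMinimal_of_minCertified` (no hypothesis),
  `Rank3Row.minCertified_of_minimalCertified`;
* the position-indexed data check `posCheck rows n ps` (one pass over the table) and what it yields
  per entry, `minCheck_of_posCheck`;
* headline `Rank3Row.rank3_lderiv_eq_zero_kernel_m` (`hmin` discharged; `hw`, `hN` kept — these rows
  have no root-number certificate).

References: Silverman *AEC* VII.1 Rem. 1.1 [SilvermanAEC2009]; Cremona 1997 [CremonaAlgorithms1997];
Gross 1991 [GrossLMS1991].
-/

set_option linter.dupNamespace false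
set_option autoImplicit false

open WeierstrassCurve IsDedekindDomain Literature Literature.NumberTheory.EllipticCurves
  Literature.NumberTheory.Sieve
open Literature.NumberTheory.EllipticCurves.Rank1Residual.X11RankOneCertificates (discOf c4Of
  isGloballyMinimal_of_int_criterion)

namespace Summit.BirchSwinnertonDyer.BirchSwinnertonDyer.Rank2Observatory

namespace RootNumber

/-- Minimality-only local check at a listed odd prime: `p` prime (certificate `s = ⌊√p⌋`), and
`p ∤ c₄`, or `pᵉ ∥ Δ` with `e < 12` or (`pᵗ ∥ c₄` and `t < 4`). [cite: SilvermanAEC2009, VII.1 Remark 1.1] -/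
def OddEntry.minCheck (W₀ : WeierstrassCurve ℤ) (E : OddEntry) : Bool :=
  GoldbachLinnik.primeCert E.p (E.s + 1) &&
    (decide (¬ (E.p : ℤ) ∣ W₀.c₄) ||
      (exactPow E.p E.e W₀.Δ && (decide (E.e < 12) || (exactPow E.p E.t.toNat W₀.c₄ && decide (E.t.toNat < 4)))))

/-- Minimality-only certificate check: every listed entry passes `OddEntry.minCheck`,
`|Δ| = 2^{k2} ∏ pᵉ` (no other prime divides `Δ`), and at `2`: `2^{k2} ∥ Δ ∧ k2 < 12` or
`2^{k4} ∥ c₄ ∧ k4 < 4`. [cite: SilvermanAEC2009, VII.1 Remark 1.1] -/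
def RNCert.minCheck (W₀ : WeierstrassCurve ℤ) (c : RNCert) : Bool :=
  c.odd.all (OddEntry.minCheck W₀) &&
    decide (W₀.Δ.natAbs = 2 ^ c.k2 * (c.odd.map fun E => E.p ^ E.e).prod) &&
    ((exactPow 2 c.k2 W₀.Δ && decide (c.k2 < 12)) || (exactPow 2 c.k4 W₀.c₄ && decide (c.k4 < 4)))

end RootNumber

open RootNumber

section IntModel

variable {W₀ : WeierstrassCurve ℤ} {c : RNCert}

/-- Every prime factor of `Δ` is `2` or listed (minimality-only check). [folklore] -/
theorem mem_of_prime_dvd_min (hc : c.minCheck W₀ = true) {p : ℕ} (hp : p.Prime)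
    (hpd : (p : ℤ) ∣ W₀.Δ) : p = 2 ∨ ∃ E ∈ c.odd, E.minCheck W₀ = true ∧ E.p = p := by
  simp only [RNCert.minCheck, Bool.and_eq_true, decide_eq_true_eq, List.all_eq_true] at hc
  obtain ⟨⟨hall, hfac⟩, -⟩ := hc
  have h1 : p ∣ W₀.Δ.natAbs := Int.natCast_dvd.mp hpd
  rw [hfac] at h1
  rcases (Nat.Prime.dvd_mul hp).mp h1 with h | h
  · exact Or.inl ((Nat.prime_dvd_prime_iff_eq hp Nat.prime_two).mp (hp.dvd_of_dvd_pow h))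
  · obtain ⟨a, ha, hpa⟩ := (Prime.dvd_prod_iff hp.prime).mp h
    obtain ⟨E, hE, rfl⟩ := List.mem_map.mp ha
    have hEc := hall E hE
    have hE' : E.p.Prime := by
      simp only [OddEntry.minCheck, Bool.and_eq_true] at hEc
      exact GoldbachLinnik.prime_of_primeCert hEc.1
    exact Or.inr ⟨E, hE, hEc, ((Nat.prime_dvd_prime_iff_eq hp hE').mp (hp.dvd_of_dvd_pow hpa)).symm⟩

/-- **Silverman's criterion at every prime** from a minimality-only certificate.
[cite: SilvermanAEC2009, VII.1 Remark 1.1] -/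
theorem int_criterion_of_minCheck (hc : c.minCheck W₀ = true) :
    ∀ q : ℕ, q.Prime → ¬ ((q : ℤ) ^ 12 ∣ W₀.Δ ∧ (q : ℤ) ^ 4 ∣ W₀.c₄) := by
  rintro q hq ⟨h12, h4⟩
  have hqΔ : (q : ℤ) ∣ W₀.Δ := dvd_trans (dvd_pow_self _ (by norm_num)) h12
  rcases mem_of_prime_dvd_min hc hq hqΔ with rfl | ⟨E, -, hE, rfl⟩
  · simp only [RNCert.minCheck, Bool.and_eq_true, Bool.or_eq_true, decide_eq_true_eq] at hc
    rcases hc.2 with ⟨hk2, hk⟩ | ⟨hk4, hk⟩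
    · exact (exactPow_spec hk2).2 (dvd_trans (pow_dvd_pow _ (by omega : c.k2 + 1 ≤ 12)) h12)
    · exact (exactPow_spec hk4).2 (dvd_trans (pow_dvd_pow _ (by omega : c.k4 + 1 ≤ 4)) h4)
  · simp only [OddEntry.minCheck, Bool.and_eq_true, Bool.or_eq_true, decide_eq_true_eq] at hE
    rcases hE.2 with hnd | ⟨he, hmin⟩
    · exact hnd (dvd_trans (dvd_pow_self _ (by norm_num)) h4)
    · rcases hmin with he12 | ⟨ht, ht4⟩
      · exact (exactPow_spec he).2 (dvd_trans (pow_dvd_pow _ (by omega : E.e + 1 ≤ 12)) h12)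
      · exact (exactPow_spec ht).2 (dvd_trans (pow_dvd_pow _ (by omega : E.t.toNat + 1 ≤ 4)) h4)

/-- **A root-number certificate passing `min2` passes the minimality-only check.** [folklore] -/
theorem minCheck_of_check (hc : c.check W₀ = true) (hm : c.min2 W₀ = true) : c.minCheck W₀ = true := by
  obtain ⟨hk2, hk4, -, -, hall, hfac⟩ := RNCert.check_spec hc
  simp only [RNCert.min2, Bool.or_eq_true, Bool.and_eq_true, decide_eq_true_eq] at hm
  simp only [RNCert.minCheck, Bool.and_eq_true, Bool.or_eq_true, decide_eq_true_eq, List.all_eq_true]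
  refine ⟨⟨fun E hE ↦ ?_, hfac⟩, ?_⟩
  · have h := hall E hE
    obtain ⟨-, -, -, hK0, hK1, hK2⟩ := OddEntry.check_spec h
    simp only [OddEntry.minCheck, Bool.and_eq_true, Bool.or_eq_true, decide_eq_true_eq]
    refine ⟨?_, ?_⟩
    · simp only [OddEntry.check, Bool.and_eq_true] at h
      exact h.1.1.1
    · by_cases h0 : E.kind = 0
      · exact Or.inl (hK0 h0).1
      by_cases h1 : E.kind = 1
      · exact Or.inl (hK1 h1).1
      · obtain ⟨-, heΔ, -, htc, hmin⟩ := hK2 h0 h1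
        exact Or.inr ⟨heΔ, hmin.imp id fun ht ↦ ⟨htc, ht⟩⟩
  · rcases hm with hk | ⟨hc0, hk⟩
    · exact Or.inl ⟨hk2, hk⟩
    · exact Or.inr ⟨hk4.resolve_left hc0, hk⟩

end IntModel

/-! ### Rows -/

/-- A row is MINIMALITY CERTIFIED (minimality-only form) if some certificate passes `minCheck` on its
integer model. [folklore] -/
def Rank3Row.MinCertified (r : Rank3Row) : Prop := ∃ c : RNCert, c.minCheck r.intModel = true

/-- **Cremona's equation of a `MinCertified` row is a global minimal model** — no hypothesis.
[cite: SilvermanAEC2009, VII.1 Remark 1.1] -/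
theorem Rank3Row.isGloballyMinimal_of_minCertified {r : Rank3Row} (h : r.MinCertified) :
    r.curve.IsGloballyMinimal := by
  obtain ⟨c, hc⟩ := h
  have hcrit := int_criterion_of_minCheck hc
  rw [← discOf_eq, ← c4Of_eq] at hcrit
  exact isGloballyMinimal_of_int_criterion r.a₁ r.a₂ r.a₃ r.a₄ r.a₆ hcrit

/-- The root-number form implies the minimality-only form. [folklore] -/
theorem Rank3Row.minCertified_of_minimalCertified {r : Rank3Row} (h : r.MinimalCertified) :
    r.MinCertified := by
  obtain ⟨c, hc, hm⟩ := h
  exact ⟨c, minCheck_of_check hc hm⟩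

/-- Position-indexed data check, ONE pass over the table: `ps` lists `(row index, certificate)` with
increasing indices; `n` is the index of the current head row. [folklore] -/
def posCheck : List Rank3Row → ℕ → List (ℕ × RNCert) → Bool
  | _, _, [] => true
  | [], _, _ :: _ => false
  | r :: rs, n, (i, c) :: rest =>
      if i = n then c.minCheck r.intModel && posCheck rs (n + 1) rest
      else posCheck rs (n + 1) ((i, c) :: rest)

/-- What a passing position-indexed check says about each listed pair. [folklore] -/
theorem minCheck_of_posCheck :
    ∀ (rows : List Rank3Row) (n : ℕ) (ps : List (ℕ × RNCert)), posCheck rows n ps = true →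
      ∀ (i : ℕ) (c : RNCert), (i, c) ∈ ps →
        n ≤ i ∧ ∃ r : Rank3Row, rows[i - n]? = some r ∧ c.minCheck r.intModel = true
  | _, _, [], _, i, c, hm => by simp at hm
  | [], _, _ :: _, h, _, _, _ => by simp [posCheck] at h
  | r :: rs, n, (j, d) :: rest, h, i, c, hm => by
    by_cases hj : j = n
    · subst hj
      simp only [posCheck, ↓reduceIte, Bool.and_eq_true] at h
      rcases List.mem_cons.mp hm with he | hm'
      · obtain ⟨rfl, rfl⟩ := Prod.mk.inj he
        exact ⟨le_rfl, r, by simp, h.1⟩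
      · obtain ⟨hle, r', hr', hc⟩ := minCheck_of_posCheck rs (j + 1) rest h.2 i c hm'
        refine ⟨by omega, r', ?_, hc⟩
        rw [show i - j = (i - (j + 1)) + 1 by omega, List.getElem?_cons_succ]
        exact hr'
    · simp only [posCheck, hj, ↓reduceIte] at h
      obtain ⟨hle, r', hr', hc⟩ := minCheck_of_posCheck rs (n + 1) ((j, d) :: rest) h i c hm
      refine ⟨by omega, r', ?_, hc⟩
      rw [show i - n = (i - (n + 1)) + 1 by omega, List.getElem?_cons_succ]
      exact hr'

/-- Table form (`n = 0`): a listed pair certifies its row. [folklore] -/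
theorem Rank3Row.minCertified_of_posCheck {rows : List Rank3Row} {ps : List (ℕ × RNCert)}
    (h : posCheck rows 0 ps = true) {i : ℕ} {c : RNCert} (hm : (i, c) ∈ ps) :
    ∃ hi : i < rows.length, (rows[i]'hi).MinCertified := by
  obtain ⟨-, r, hr, hc⟩ := minCheck_of_posCheck rows 0 ps h i c hm
  rw [Nat.sub_zero] at hr
  obtain ⟨hi, rfl⟩ := List.getElem?_eq_some_iff.mp hr
  exact ⟨hi, c, hc⟩

/-- **`L′(E,1) = 0` over `K = ℚ(√D)`** for a `MinCertified` row: the census headline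
`Rank3Row.rank3_lderiv_eq_zero_kernel` with `hmin` DISCHARGED (`hw`, `hN` kept — meant for the rows
without a root-number certificate). [cite: GrossLMS1991, (1.1) and Thm. 1.3] -/
theorem Rank3Row.rank3_lderiv_eq_zero_kernel_m {r : Rank3Row} (hr : r ∈ rank3Table)
    (hmc : r.MinCertified) (K : Type) [Field K] [NumberField K]
    (hE : WeierstrassCurve.hasEntireLFunction_rat)
    (hGZKK : mordellWeilRank_eq_one_of_LDerivEK_ne_zero r.curve K)
    (hN : r.curve.conductorNorm ℤ = r.N) (hK : IsImaginaryQuadratic K) (hdK : NumberField.discr K = r.D)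
    (hw : r.curve.rootNumber = -1) (hLD : (r.curve.quadraticTwist (r.D : ℚ)).entireLFunction 1 ≠ 0) :
    deriv r.curve.entireLFunction 1 = 0 :=
  Rank3Row.rank3_lderiv_eq_zero_kernel hr K hE hGZKK (Rank3Row.isGloballyMinimal_of_minCertified hmc)
    hN hK hdK hw hLD

/-- Self-test (kernel): row `30` (`27747c1 = [0,0,1,-327,2286]`), minimality-only certificate `⟨0, 4, 3, [(3: e=8, t=2), (3083)]⟩`
— additive at `3` with `3² ∥ c₄`, so minimal at `3` although no root-number certificate exists.
[cite: CremonaAlgorithms1997, Tables] -/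
example : RNCert.minCheck (rank3Table[30]'(by rw [rank3Table_length]; norm_num)).intModel
    ⟨0, 4, 3, [⟨3, 1, 8, 2, 2⟩, ⟨3083, 55, 1, 0, 0⟩]⟩ = true := by
  decide +kernel

end Summit.BirchSwinnertonDyer.BirchSwinnertonDyer.Rank2Observatory
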